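import Mathlib
import Literature.Analysis.OperatorTheory.KernelConjugation
import Literature.Analysis.Complex.ConeTubeIdentity
import HarnessLib

/-!
# The norm identity for real-symmetric holomorphic vector families in a kernel Hilbert space

Setting of `KernelConjugation`: kernel vectors `δ : X → H` with dense span and real Gram matrix,
conjugation `J = conjOp δ`, bilinear pairing `β = pairing δ`. The single result
`inner_self_eq_of_conjOp_eq`: a vector family `V` holomorphic on a rectangle
`|Re ζ - θ₀| < ε, |Im ζ| < R`, real-symmetric (`J V(ζ̄) = V(ζ)`), equal to kernel vectors `δ_{c(θ)}`
at the real angles, and with Gram entries `⟪δ_{c(θ-s)}, δ_{c(θ+s)}⟫` independent of `s`, satisfies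
`⟪V ζ, V ζ⟫ = ⟪δ_{c(Re ζ)}, δ_{c(Re ζ)}⟫` on the rectangle. Proof: `s ↦ β(V(Re ζ - s), V(Re ζ + s))` is
holomorphic (`DifferentiableOn.kernelPairing`), constant on the real points, hence constant
(`eqOn_const_of_isPreconnected_of_eq_ofReal`), and at `s = i Im ζ` it equals `β(J V ζ, V ζ) = ⟪V ζ, V ζ⟫`.
This is the mechanism by which Euclidean invariance of LOWER correlation functions makes the
boosted cluster vectors of the Osterwalder–Schrader calculus have angle-independent norms
(Glimm–Jaffe, *Quantum Physics* (1987), §19.5–19.7). [folklore]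
-/

noncomputable section

open Filter ComplexConjugate Complex Set
open scoped InnerProductSpace Topology
open Literature.Analysis.Complex

namespace Literature.Analysis.OperatorTheory

namespace KernelVectors

variable {X : Type*} {H : Type*} [NormedAddCommGroup H] [InnerProductSpace ℂ H]

/-- **Norm identity.** Let `V` be holomorphic on the rectangle `|Re ζ - θ₀| < ε`, `|Im ζ| < R`,
real-symmetric (`J V(ζ̄) = V(ζ)`), equal to kernel vectors `δ_{c θ}` at the real angles of the
rectangle, and suppose the Gram entries `⟪δ_{c(θ-s)}, δ_{c(θ+s)}⟫` do not depend on `s`. Then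
`⟪V ζ, V ζ⟫ = ⟪δ_{c(Re ζ)}, δ_{c(Re ζ)}⟫` on the rectangle: the holomorphic function
`s ↦ β(V(Re ζ - s), V(Re ζ + s))` is constant on the reals, hence constant, and at `s = i Im ζ` it is
`β(J V ζ, V ζ) = ⟪V ζ, V ζ⟫`. (This is how rotation invariance of the LOWER correlation functions
makes the boosted block vectors of the Osterwalder–Schrader calculus have angle-independent norms.)
[folklore] -/
theorem inner_self_eq_of_conjOp_eq [CompleteSpace H] (δ : X → H)
    (hδ : DenseRange (Finsupp.linearCombination ℂ δ)) (hreal : ∀ x y, (⟪δ x, δ y⟫_ℂ).im = 0)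
    {V : ℂ → H} {θ₀ ε R : ℝ}
    (hV : DifferentiableOn ℂ V {ζ : ℂ | |ζ.re - θ₀| < ε ∧ |ζ.im| < R})
    (hJ : ∀ ζ : ℂ, |ζ.re - θ₀| < ε → |ζ.im| < R → conjOp δ (V (conj ζ)) = V ζ)
    (c : ℝ → X) (hc : ∀ θ : ℝ, |θ - θ₀| < ε → V θ = δ (c θ))
    (hK : ∀ θ s : ℝ, |θ - s - θ₀| < ε → |θ + s - θ₀| < ε →
      ⟪δ (c (θ - s)), δ (c (θ + s))⟫_ℂ = ⟪δ (c θ), δ (c θ)⟫_ℂ)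
    {ζ : ℂ} (hζ : |ζ.re - θ₀| < ε) (hζ' : |ζ.im| < R) :
    ⟪V ζ, V ζ⟫_ℂ = ⟪δ (c ζ.re), δ (c ζ.re)⟫_ℂ := by
  set θ' : ℝ := ζ.re with hθ'
  set D' : Set ℂ := {w : ℂ | |w.re| < ε - |θ' - θ₀| ∧ |w.im| < R} with hD'
  have hD'o : IsOpen D' :=
    (isOpen_lt (continuous_abs.comp continuous_re) continuous_const).inter
      (isOpen_lt (continuous_abs.comp continuous_im) continuous_const)
  have hD'c : IsPreconnected D' := by
    have h1 : Convex ℝ {w : ℂ | |w.re| < ε - |θ' - θ₀|} := by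
      have : {w : ℂ | |w.re| < ε - |θ' - θ₀|} = {w : ℂ | w.re < ε - |θ' - θ₀|} ∩ {w : ℂ | -(ε - |θ' - θ₀|) < w.re} := by
        ext w; simp only [mem_setOf_eq, mem_inter_iff, abs_lt]; tauto
      rw [this]; exact (convex_halfSpace_re_lt _).inter (convex_halfSpace_re_gt _)
    have h2 : Convex ℝ {w : ℂ | |w.im| < R} := by
      have : {w : ℂ | |w.im| < R} = {w : ℂ | w.im < R} ∩ {w : ℂ | -R < w.im} := by
        ext w; simp only [mem_setOf_eq, mem_inter_iff, abs_lt]; tauto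
      rw [this]; exact (convex_halfSpace_im_lt _).inter (convex_halfSpace_im_gt _)
    exact (h1.inter h2).isPreconnected
  -- the two affine maps into the rectangle
  have hmaps₁ : ∀ w ∈ D', |((θ' : ℂ) - w).re - θ₀| < ε ∧ |((θ' : ℂ) - w).im| < R := by
    rintro w ⟨h1, h2⟩
    constructor
    · have : ((θ' : ℂ) - w).re - θ₀ = (θ' - θ₀) - w.re := by simp; ring
      rw [this]
      calc |θ' - θ₀ - w.re| ≤ |θ' - θ₀| + |w.re| := abs_sub _ _
        _ < ε := by linarith
    · simpa using h2
  have hmaps₂ : ∀ w ∈ D', |((θ' : ℂ) + w).re - θ₀| < ε ∧ |((θ' : ℂ) + w).im| < R := by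
    rintro w ⟨h1, h2⟩
    constructor
    · have : ((θ' : ℂ) + w).re - θ₀ = (θ' - θ₀) + w.re := by simp; ring
      rw [this]
      calc |θ' - θ₀ + w.re| ≤ |θ' - θ₀| + |w.re| := abs_add_le _ _
        _ < ε := by linarith
    · simpa using h2
  -- the holomorphic pairing
  set P : ℂ → ℂ := fun w => pairing δ hδ hreal (V ((θ' : ℂ) - w)) (V ((θ' : ℂ) + w)) with hP
  have hPd : DifferentiableOn ℂ P D' := by
    refine DifferentiableOn.kernelPairing δ hδ hreal ?_ ?_
    · exact hV.comp ((differentiableOn_const _).sub differentiableOn_id) hmaps₁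
    · exact hV.comp ((differentiableOn_const _).add differentiableOn_id) hmaps₂
  -- constant on the real points
  have hPreal : ∀ r : ℝ, (r : ℂ) ∈ D' → P r = ⟪δ (c θ'), δ (c θ')⟫_ℂ := by
    intro r hr
    obtain ⟨h1, h2⟩ := hmaps₁ r hr
    obtain ⟨h3, h4⟩ := hmaps₂ r hr
    have e1 : (θ' : ℂ) - r = ((θ' - r : ℝ) : ℂ) := by push_cast; ring
    have e2 : (θ' : ℂ) + r = ((θ' + r : ℝ) : ℂ) := by push_cast; ring
    rw [e1] at h1; rw [e2] at h3
    simp only [Complex.ofReal_re] at h1 h3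
    show pairing δ hδ hreal (V ((θ' : ℂ) - r)) (V ((θ' : ℂ) + r)) = _
    rw [e1, e2, hc _ h1, hc _ h3, pairing_gen_left, hK θ' r h1 h3]
  have h0 : ((0 : ℝ) : ℂ) ∈ D' := by
    refine ⟨?_, ?_⟩
    · simp only [Complex.ofReal_zero, Complex.zero_re, abs_zero, sub_pos]; exact hζ
    · simp only [Complex.ofReal_zero, Complex.zero_im, abs_zero]
      exact (abs_nonneg _).trans_lt hζ'
  have hconst := eqOn_const_of_isPreconnected_of_eq_ofReal hD'o hD'c h0 hPd hPreal
  -- evaluate at `s = i Im ζ`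
  have hmem : ((ζ.im : ℂ) * I) ∈ D' := by
    refine ⟨?_, ?_⟩
    · simp only [Complex.mul_re, Complex.ofReal_re, Complex.I_re, mul_zero, Complex.ofReal_im,
        Complex.I_im, mul_one, sub_self, abs_zero, sub_pos]; exact hζ
    · simpa using hζ'
  have key := hconst hmem
  simp only [hP] at key
  have e1 : (θ' : ℂ) + ζ.im * I = ζ := by rw [hθ']; exact Complex.re_add_im ζ
  have e2 : (θ' : ℂ) - ζ.im * I = conj ζ := by
    apply Complex.ext <;> simp [hθ']
  rw [e1, e2] at key
  have hVc : V (conj ζ) = conjOp δ (V ζ) := by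
    rw [← hJ ζ hζ hζ', conjOp_conjOp δ hδ hreal]
  rw [hVc, ← inner_self_eq_pairing δ hδ hreal] at key
  exact key


end KernelVectors

end Literature.Analysis.OperatorTheory
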